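import Summits.AtomisticToContinuum.BoseEinsteinCondensation.Theorems.BECCutLineWeakDisorderTaggedShiftDefs
import Summits.AtomisticToContinuum.BoseEinsteinCondensation.Theorems.BECCutLineWeakDisorderTaggedShiftCoarseFreeGas
import Summits.AtomisticToContinuum.BoseEinsteinCondensation.Theorems.BECCutLineWeakDisorderTwoReplicaTransienceBoundFreeGas
import HarnessLib

/-!
# Route `BECCutLineWeakDisorder`, crux `TwoReplicaTransienceBound` (stmt-AtomisticToContinuum-9687),
# line `across-cut-thinning` (v2, lead c6): the FREE-GAS row of the shared UV stub
# `KineticScaleFlatnessBeyond`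

Support file (`--supports stmt-AtomisticToContinuum-9687`; proves the registered CALIBRATION stub
`stub_kineticScaleFlatnessBeyondFreeGas : Goal.stub_kineticScaleFlatnessBeyondFreeGas`, NOT the
registered stub `stub_kineticScaleFlatnessBeyond : Goal.stub_kineticScaleFlatnessBeyond`
(`= TaggedShiftLogHarnack.KineticScaleFlatnessBeyond` of
`Theorems/BECCutLineWeakDisorderTaggedShiftDefs.lean`, the UV module shared by the lines
`across-cut-thinning` and `tagged-shift-log-harnack`, conjectural for interacting `v`).

The statement `KineticScaleFlatnessBeyond` asks, for every admissible `v`, for a bound on the second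
moment under the slice law `m_T(Y) dY` of the `a_Q²`-weighted within-block participation
`r̄_K = uvParticipation` of the slice `|Ψ_T(·,Y)|` at the kinetic depth `K = kineticDepth κ ρ L`,
uniformly in `n` and in `T ≥ Aκ/ρ`. Its `v ≡ 0` row holds with ONE absolute constant for every
`L > 0`, every `n`, every `T ≥ 0` and EVERY depth `K` (`kineticFlatness_freeGas`):

* pointwise in the slice, `s² · r̄_K ≤ L³ · m` (`s = ∫ g`, `m = ∫ g²`; covering of `Λ_L` by the
  `8^K` blocks of level `K`, finite Cauchy–Schwarz `s² ≤ 8^K S_K`, `ℓ_K³ 8^K = L³`,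
  `ENNReal.mul_div_le`; private copies, adapted from the checked skeleton
  `Cruxes/TwoReplicaTransienceBound/Lines/across_cut_thinning.lean`, of the lead's bookkeeping lemmas —
  private so as not to collide with `Theorems/BECCutLineWeakDisorderAcrossCutBookkeeping.lean`), hence
  `r̄_K ≤ L³ m / s²` whenever `0 < s < ∞`;
* for the free gas the slice is `Y`-independent up to a scalar, `|Ψ_T(·,Y)| = d(Y) · θ_T`
  (`fkPartition_vecCons_free`; `θ_T = Z^{(1)}_T` the one-line Dirichlet survival profile), and `r̄_K`
  is scale-free (`uvParticipation_const_mul`), so off the null slices `r̄_K(|Ψ_T(·,Y)|) = r̄_K(θ_T)`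
  is the DETERMINISTIC number `≤ L³ ∫θ_T² / (∫θ_T)² ≤ C₀` (`free_ratio_le`, the landed free-gas crux
  bound of `Theorems/BECCutLineWeakDisorderTwoReplicaTransienceBoundFreeOneRatio.lean`);
* the slice law has mass `≤ 1` (`lintegral_lintegral_slice_sq`; `0` if the normalisation
  degenerates), so `∫ m_T r̄_K² ≤ C₀²`.

`stub_kineticScaleFlatnessBeyondFreeGas` is then the `v := fun _ => 0` instance of
`KineticScaleFlatnessBeyond` with all its other quantifiers verbatim (`κ₀ = A = ρ₀ = 1` are idle:
`Aκ/ρ ≤ T` forces `0 ≤ T`); `stub_kineticScaleFlatnessBeyondFreeGas_of` records that it IS that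
instance (it follows from `KineticScaleFlatnessBeyond` by `isRepulsiveFiniteRange_zero`).

Junk audit of `KineticScaleFlatnessBeyond` as typed (no junk fires): a slice with `s(Y) = 0`
vanishes a.e., so `m(Y) = 0`, `S_K = 0`, `r̄_K = ℓ³·0/0 = 0` and the integrand is `0 · 0² = 0`;
`s(Y) = ⊤` never happens (the slice is `≤ 1/√𝒩` on a box of finite volume); `0 < s < ∞` gives
`0 < S_K < ∞` (`s² ≤ 8^K S_K`, `S_K ≤ (Σ a_Q)²`), so `r̄_K = ℓ³ m/S_K ∈ [1, L³m/s²]` is an honest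
finite number and the integrand is `≥ m(Y)` there — with `∫ m = 1` the constant is `≥ 1`, as
`Negative/ConstantAtLeastOne` demands; a degenerate normalisation `𝒩 ∈ {0, ⊤}` makes the witness and
the integral vanish; `kineticDepth` is a natural subtraction (never finer than `depth L`, documented).
-/

noncomputable section

open MeasureTheory Filter Set Finset
open scoped ENNReal NNReal Topology BigOperators

namespace Summit.AtomisticToContinuum.BoseEinsteinCondensation.Cruxes.TwoReplicaTransienceBound.AcrossCutThinning

open Literature.MathematicalPhysics.QuantumManyBody.BoseGas
open Summit.AtomisticToContinuum.BoseEinsteinCondensation.Theses.BECCutLineWeakDisorder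
open Summit.AtomisticToContinuum.BoseEinsteinCondensation.Cruxes.LandscapeBound.SiblingTelescopingChaining
open Summit.AtomisticToContinuum.BoseEinsteinCondensation.Cruxes.TwoReplicaTransienceBound.TracerDecoupling
  (fkWitness_one_eq fkPartition_ne_top)
open Summit.AtomisticToContinuum.BoseEinsteinCondensation.Cruxes.TwoReplicaTransienceBound.FreeGas
  (fkPartition_vecCons_free free_ratio_le measurable_fkPartition_one)
open Summit.AtomisticToContinuum.BoseEinsteinCondensation.Cruxes.TwoReplicaTransienceBound.TaggedShiftLogHarnack
  (kineticDepth KineticScaleFlatnessBeyond isRepulsiveFiniteRange_zero)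
open Summit.AtomisticToContinuum.BoseEinsteinCondensation.Theorems.CutLineWitness (volume_box_ne_top)

variable {n : ℕ}

/-! ### Pointwise: `s² · r̄_K ≤ L³ · m` (private copies of the line's bookkeeping lemmas) -/

-- adapted from Cruxes/TwoReplicaTransienceBound/Lines/across_cut_thinning.lean (`sq_sum_le_card_mul_sum_sq`)
/-- Cauchy–Schwarz for a finite `ℝ≥0∞`-sum: `(Σ_e a_e)² ≤ #s · Σ_e a_e²`. [folklore] -/
private theorem sq_sum_le_card_mul_sum_sq {ι : Type*} (s : Finset ι) (a : ι → ℝ≥0∞) :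
    (∑ e ∈ s, a e) ^ 2 ≤ (s.card : ℝ≥0∞) * ∑ e ∈ s, a e ^ 2 := by
  have h := ENNReal.rpow_sum_le_const_mul_sum_rpow s a (p := 2) (by norm_num)
  norm_num at h
  simpa [ENNReal.rpow_two] using h

-- adapted from Cruxes/TwoReplicaTransienceBound/Lines/across_cut_thinning.lean (`card_blocks`)
/-- The number of level-`K` blocks is `8^K`. [folklore] -/
private theorem card_blocks (K : ℕ) :
    ((Finset.univ : Finset (Fin 3 → Fin (2 ^ K))).card : ℝ≥0∞) = 8 ^ K := by
  rw [Finset.card_univ, Fintype.card_fun, Fintype.card_fin, Fintype.card_fin]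
  push_cast
  rw [← pow_mul, mul_comm, pow_mul]
  norm_num

-- adapted from Cruxes/TwoReplicaTransienceBound/Lines/across_cut_thinning.lean (`sq_lintegral_le_levelSq`)
/-- `s² ≤ 8^K S_K` for a slice vanishing off the box (covering by blocks + Cauchy–Schwarz over
blocks). [folklore] -/
private theorem sq_lintegral_le_levelSq {g : Space → ℝ≥0∞} {L : ℝ} (hL : 0 < L)
    (h0 : ∀ x, x ∉ box L → g x = 0) (K : ℕ) :
    (∫⁻ x, g x) ^ 2 ≤ 8 ^ K * levelSq g L K := by
  calc (∫⁻ x, g x) ^ 2 ≤ (∑ i : Fin 3 → Fin (2 ^ K), blockMass g L K i) ^ 2 := by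
        gcongr
        exact lintegral_le_sum_blockMass hL h0 K
    _ ≤ ((Finset.univ : Finset (Fin 3 → Fin (2 ^ K))).card : ℝ≥0∞) *
          ∑ i : Fin 3 → Fin (2 ^ K), blockMass g L K i ^ 2 := sq_sum_le_card_mul_sum_sq _ _
    _ = 8 ^ K * levelSq g L K := by rw [card_blocks]; rfl

-- adapted from Cruxes/TwoReplicaTransienceBound/Lines/across_cut_thinning.lean (`blockVol_mul_card`)
/-- `ℓ_K³ · 8^K = L³` in `[0, ∞]`. [folklore] -/
private theorem blockVol_mul_card {L : ℝ} (hL : 0 ≤ L) (K : ℕ) :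
    ENNReal.ofReal ((L / 2 ^ K) ^ 3) * 8 ^ K = ENNReal.ofReal (L ^ 3) := by
  rw [show (8 : ℝ≥0∞) ^ K = ENNReal.ofReal ((8 : ℝ) ^ K) by
      rw [ENNReal.ofReal_pow (by norm_num)]; norm_num,
    ← ENNReal.ofReal_mul (by positivity)]
  congr 1
  rw [div_pow, show ((2 : ℝ) ^ K) ^ 3 = 8 ^ K by rw [← pow_mul, mul_comm, pow_mul]; norm_num]
  field_simp

-- adapted from Cruxes/TwoReplicaTransienceBound/Lines/across_cut_thinning.lean (`sq_mul_uv_le`)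
/-- **Pointwise: `s² · r̄_K ≤ L³ m`** (no side conditions: `ENNReal.mul_div_le`). [folklore] -/
private theorem sq_mul_uv_le {g : Space → ℝ≥0∞} {L : ℝ} (hL : 0 < L)
    (h0 : ∀ x, x ∉ box L → g x = 0) (K : ℕ) :
    (∫⁻ x, g x) ^ 2 * uvParticipation g L K ≤ ENNReal.ofReal (L ^ 3) * ∫⁻ x, g x ^ 2 := by
  unfold uvParticipation
  calc (∫⁻ x, g x) ^ 2 * (ENNReal.ofReal ((L / 2 ^ K) ^ 3) * (∫⁻ x, g x ^ 2) / levelSq g L K)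
      ≤ (8 ^ K * levelSq g L K) *
          (ENNReal.ofReal ((L / 2 ^ K) ^ 3) * (∫⁻ x, g x ^ 2) / levelSq g L K) :=
        mul_le_mul' (sq_lintegral_le_levelSq hL h0 K) le_rfl
    _ = 8 ^ K * (levelSq g L K *
          (ENNReal.ofReal ((L / 2 ^ K) ^ 3) * (∫⁻ x, g x ^ 2) / levelSq g L K)) := by ring
    _ ≤ 8 ^ K * (ENNReal.ofReal ((L / 2 ^ K) ^ 3) * ∫⁻ x, g x ^ 2) :=
        mul_le_mul' le_rfl ENNReal.mul_div_le
    _ = ENNReal.ofReal (L ^ 3) * ∫⁻ x, g x ^ 2 := by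
        rw [← mul_assoc, mul_comm (8 ^ K : ℝ≥0∞), blockVol_mul_card hL.le]

/-- **The within-block participation is at most the full participation ratio**: for `g ≥ 0`
vanishing off `Λ_L` (`L > 0`) with `0 < ∫ g < ∞`, and EVERY depth `K`,
`r̄_K(g) ≤ L³ ∫ g² / (∫ g)²` (`sq_mul_uv_le` divided through). [folklore] -/
theorem uvParticipation_le_ratio {g : Space → ℝ≥0∞} {L : ℝ} (hL : 0 < L)
    (h0 : ∀ x, x ∉ box L → g x = 0) (hs0 : ∫⁻ x, g x ≠ 0) (hst : ∫⁻ x, g x ≠ ⊤) (K : ℕ) :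
    uvParticipation g L K ≤ ENNReal.ofReal (L ^ 3) * (∫⁻ x, g x ^ 2) / (∫⁻ x, g x) ^ 2 := by
  rw [ENNReal.le_div_iff_mul_le (Or.inl (pow_ne_zero 2 hs0)) (Or.inl (ENNReal.pow_ne_top hst)),
    mul_comm]
  exact sq_mul_uv_le hL h0 K

/-! ### The free gas: the UV stub holds with one constant for every `L`, `n`, `T ≥ 0` and every depth -/

/-- **Free gas: the slice-law second moment of the within-block participation is bounded by ONE
absolute constant**, for `v ≡ 0`, every `L > 0`, every `n`, every `T ≥ 0` and EVERY depth `K`: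
`∫ m_T(Y) r̄_K(|Ψ_T(·,Y)|)² dY ≤ C`, `Ψ_T = fkWitness 0 L T 1`. The slice is
`|Ψ_T(·,Y)| = c Z_n(Y) · θ_T` (`fkPartition_vecCons_free`; `θ_T = Z^{(1)}_T` the one-line Dirichlet
survival profile), `r̄_K` is scale-free (`uvParticipation_const_mul`), so the second factor is the
deterministic `r̄_K(θ_T)² ≤ (L³∫θ_T²/(∫θ_T)²)² ≤ C₀²` (`uvParticipation_le_ratio`, `free_ratio_le`),
and `∫ m_T = 1` (or `0` if the normalisation degenerates). [folklore] -/
theorem kineticFlatness_freeGas : ∃ C : ℝ, 0 < C ∧ ∀ L : ℝ, 0 < L → ∀ (n : ℕ) (T : ℝ), 0 ≤ T →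
    ∀ K : ℕ,
      ∫⁻ Y : Config n,
          (∫⁻ x, slice (fkWitness (N := n + 1) (fun _ => 0) L T (fun _ => (1 : ℝ≥0∞))) Y x ^ 2) *
            uvParticipation (slice (fkWitness (N := n + 1) (fun _ => 0) L T (fun _ => (1 : ℝ≥0∞))) Y)
              L K ^ 2 ≤
        ENNReal.ofReal C := by
  obtain ⟨C₀, hC₀t, hC₀⟩ := free_ratio_le
  refine ⟨C₀.toReal ^ 2 + 1, by positivity, fun L hL n T hT K => ?_⟩
  have hvm : Measurable (fun _ : ℝ => (0 : ℝ≥0∞)) := measurable_const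
  set Ψ : Config (n + 1) → ℝ := fkWitness (N := n + 1) (fun _ => 0) L T (fun _ => (1 : ℝ≥0∞))
    with hΨdef
  set 𝒩 : ℝ≥0∞ := fkNormSq (N := n + 1) (fun _ => 0) L T (fun _ => (1 : ℝ≥0∞)) with h𝒩def
  -- the one-line profile and the bath partition function
  set θ : Space → ℝ≥0∞ := fun x => fkPartition (N := 1) (fun _ => 0) L T (fun _ => x) with hθdef
  set Zn : Config n → ℝ≥0∞ := fun Y => fkPartition (fun _ => 0) L T Y with hZndef
  have hθm : Measurable θ := measurable_fkPartition_one hvm L T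
  have hθ1 : ∀ x, θ x ≤ 1 := fun x => fkPartition_le_one _ L T _
  have hθ0 : ∀ x, x ∉ box L → θ x = 0 := fun x hx => by
    have : (fun _ : Fin 1 => x) ∉ boxN 1 L := fun h => hx (h 0)
    simp [hθdef, fkPartition, fkSemigroup_of_notMem (fun _ => (0 : ℝ≥0∞)) hT _ this]
  have hθtop : ∫⁻ x, θ x ≠ ⊤ := by
    refine ne_top_of_le_ne_top (ENNReal.mul_ne_top ENNReal.one_ne_top (volume_box_ne_top L)) ?_
    calc ∫⁻ x, θ x ≤ ∫⁻ x, (box L).indicator 1 x := lintegral_mono fun x => by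
            by_cases hxb : x ∈ box L
            · rw [Set.indicator_of_mem hxb]; exact hθ1 x
            · rw [Set.indicator_of_notMem hxb, hθ0 x hxb]
      _ = 1 * volume (box L) := by rw [lintegral_indicator_one (measurableSet_box L), one_mul]
  -- the slice is `Y`-independent up to the scalar `d Y = c · Z_n(Y)`
  set c : ℝ := (Real.sqrt 𝒩.toReal)⁻¹ with hcdef
  set d : Config n → ℝ≥0∞ := fun Y => ENNReal.ofReal c * Zn Y with hddef
  have hdt : ∀ Y, d Y ≠ ⊤ := fun Y =>
    ENNReal.mul_ne_top ENNReal.ofReal_ne_top (fkPartition_ne_top _ L T Y)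
  have hslice : ∀ Y, slice Ψ Y = fun x => d Y * θ x := by
    intro Y
    funext x
    show ((‖Ψ (Matrix.vecCons x Y)‖₊ : ℝ≥0∞)) = d Y * θ x
    rw [coe_nnnorm_fkWitness, fkWitness_one_eq, fkPartition_vecCons_free,
      ENNReal.ofReal_mul (inv_nonneg.2 (Real.sqrt_nonneg _)),
      ENNReal.ofReal_toReal (ENNReal.mul_ne_top (fkPartition_ne_top _ L T _)
        (fkPartition_ne_top _ L T Y))]
    simp only [hddef, hθdef, hZndef, hcdef, h𝒩def]
    ring
  set m : Config n → ℝ≥0∞ := fun Y => ∫⁻ x, slice Ψ Y x ^ 2 with hmdef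
  -- total mass of the slice law is at most one
  have hm1 : ∫⁻ Y, m Y ≤ 1 := by
    by_cases hdeg : 𝒩 = 0 ∨ 𝒩 = ⊤
    · have hΨ0 : ∀ X, Ψ X = 0 := fkWitness_eq_zero_of_normSq hdeg
      have hsl : ∀ Y x, slice Ψ Y x = 0 := fun Y x => by
        simp [LandscapeBound.SiblingTelescopingChaining.slice, hΨ0]
      simp [hmdef, hsl]
    simp only [not_or] at hdeg
    exact (lintegral_lintegral_slice_sq hvm L T hdeg.1 hdeg.2).le
  -- the case of a null profile: every slice mass vanishes
  by_cases hs0 : ∫⁻ x, θ x = 0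
  · have hae : θ =ᵐ[volume] 0 := (lintegral_eq_zero_iff hθm).1 hs0
    have hm0 : ∀ Y, m Y = 0 := fun Y => by
      simp only [hmdef, hslice Y]
      refine (lintegral_eq_zero_iff ((measurable_const.mul hθm).pow_const 2)).2 ?_
      filter_upwards [hae] with x hx
      simp [hx]
    have : ∀ Y, m Y * uvParticipation (slice Ψ Y) L K ^ 2 = 0 := fun Y => by
      rw [hm0 Y, zero_mul]
    simp only [hmdef] at this
    simp [this]
  -- the generic case: the second factor is the deterministic `r̄_K(θ)² ≤ C₀²`
  have hP : uvParticipation θ L K ≤ C₀ :=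
    (uvParticipation_le_ratio hL hθ0 hs0 hθtop K).trans (hC₀ _ hvm L hL T hT)
  have hpt : ∀ Y, m Y * uvParticipation (slice Ψ Y) L K ^ 2 ≤ m Y * C₀ ^ 2 := by
    intro Y
    rcases eq_or_ne (d Y) 0 with hd0 | hd0
    · have hm0 : m Y = 0 := by simp [hmdef, hslice Y, hd0]
      rw [hm0, zero_mul, zero_mul]
    have hX : uvParticipation (slice Ψ Y) L K = uvParticipation θ L K := by
      rw [hslice Y]; exact uvParticipation_const_mul hd0 (hdt Y) θ L K
    rw [hX]
    exact mul_le_mul' le_rfl (pow_le_pow_left' hP 2)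
  calc ∫⁻ Y, m Y * uvParticipation (slice Ψ Y) L K ^ 2
      ≤ ∫⁻ Y, m Y * C₀ ^ 2 := lintegral_mono hpt
    _ = (∫⁻ Y, m Y) * C₀ ^ 2 := lintegral_mul_const' _ _ (ENNReal.pow_ne_top hC₀t)
    _ ≤ 1 * C₀ ^ 2 := mul_le_mul' hm1 le_rfl
    _ = ENNReal.ofReal (C₀.toReal ^ 2) := by
        rw [one_mul, ENNReal.ofReal_pow ENNReal.toReal_nonneg, ENNReal.ofReal_toReal hC₀t]
    _ ≤ ENNReal.ofReal (C₀.toReal ^ 2 + 1) := ENNReal.ofReal_le_ofReal (by linarith)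

/-! ### The registered calibration stub: the `v ≡ 0` row of `KineticScaleFlatnessBeyond` -/

namespace Goal

/-- Registered calibration stub `stub_kineticScaleFlatnessBeyondFreeGas` (line `across-cut-thinning`
v2, lead c6): the body of `TaggedShiftLogHarnack.KineticScaleFlatnessBeyond` with the leading
`∀ v, IsRepulsiveFiniteRange v →` dropped and `v := fun _ => 0` substituted, every other quantifier
verbatim — the free-gas (`v ≡ 0`) row of the shared UV stub `stub_kineticScaleFlatnessBeyond`. -/
abbrev stub_kineticScaleFlatnessBeyondFreeGas : Prop :=
  ∃ κ₀ : ℝ, 0 < κ₀ ∧ ∃ A : ℝ, 1 ≤ A ∧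
    ∀ κ : ℝ, 0 < κ → κ ≤ κ₀ → ∃ ρ₀ : ℝ, 0 < ρ₀ ∧ ∀ ρ : ℝ, 0 < ρ → ρ < ρ₀ →
      ∃ C : ℝ, 0 < C ∧ ∀ᶠ n : ℕ in atTop, ∀ T : ℝ, A * κ / ρ ≤ T →
        ∫⁻ Y : Config n,
            (∫⁻ x, slice (fkWitness (N := n + 1) (fun _ => 0) (sideLength ρ (n + 1)) T
              (fun _ => (1 : ℝ≥0∞))) Y x ^ 2) *
              uvParticipation
                (slice (fkWitness (N := n + 1) (fun _ => 0) (sideLength ρ (n + 1)) T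
                  (fun _ => (1 : ℝ≥0∞))) Y)
                (sideLength ρ (n + 1))
                (kineticDepth κ ρ (sideLength ρ (n + 1))) ^ 2 ≤
          ENNReal.ofReal C

end Goal

/-- The calibration statement IS the `v := fun _ => 0` instance of `KineticScaleFlatnessBeyond`
(definitional unfolding; the free gas is admissible, `isRepulsiveFiniteRange_zero`). [folklore] -/
theorem stub_kineticScaleFlatnessBeyondFreeGas_of (h : KineticScaleFlatnessBeyond) :
    Goal.stub_kineticScaleFlatnessBeyondFreeGas :=
  h _ isRepulsiveFiniteRange_zero

/-- **Registered calibration stub `stub_kineticScaleFlatnessBeyondFreeGas`: the free-gas row of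
`KineticScaleFlatnessBeyond`** — for `v ≡ 0` the slice-law second moment of the within-block
participation at the kinetic depth is bounded, beyond the kinetic time, by the absolute constant of
`kineticFlatness_freeGas` (`κ₀ = A = ρ₀ = 1` idle; `Aκ/ρ ≤ T` only through `0 ≤ T`). [folklore] -/
theorem stub_kineticScaleFlatnessBeyondFreeGas : Goal.stub_kineticScaleFlatnessBeyondFreeGas := by
  obtain ⟨C, hC, H⟩ := kineticFlatness_freeGas
  refine ⟨1, one_pos, 1, le_rfl, fun κ hκ _ => ⟨1, one_pos, fun ρ hρ _ => ⟨C, hC, ?_⟩⟩⟩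
  refine Filter.Eventually.of_forall fun n T hT => ?_
  have hL : 0 < sideLength ρ (n + 1) :=
    Real.rpow_pos_of_pos (div_pos (Nat.cast_pos.mpr n.succ_pos) hρ) _
  have hT0 : 0 ≤ T := (div_pos (by rw [one_mul]; exact hκ) hρ).le.trans hT
  exact H _ hL n T hT0 _

end Summit.AtomisticToContinuum.BoseEinsteinCondensation.Cruxes.TwoReplicaTransienceBound.AcrossCutThinning

end
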